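/-
Origin: expansion seat `planner-pub-hodgecm-pv11-g4-0`, handover #6 2026-08-18T07:13:38Z (`HOME/pub-hodgecm-pv11-g4/lean/Pv11g4/NormOneRelTorusFinite.lean`, md5 a5bff5e5, 94 lines);
landed by the gen-7 packager in gate run 25 as `HodgeCM/PerL34/NormOneRelTorusFinite.lean` (import ^import Pv[0-9]+g[0-9]+\.→import HodgeCM.PerL34. ×1).
-/
/-
Origin: expansion seat `planner-pub-hodgecm-pv11-g4-0` (unit `pub-hodgecm-pv11-g4`, DAG-NODE PROVER #11 gen 4), HodgeCM publication
cell, 2026-08-18.  WIP module `Pv11g4.NormOneRelTorusFinite`; intended landing `HodgeCM/PerL34/NormOneRelTorusFinite.lean`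
(one import rewrite: `Pv11g4.NormOneRelTorus` ↦ `HodgeCM.PerL34.NormOneRelTorus`).
-/
import Summits.HodgeConjecture.HodgeCM.PerL34.NormOneRelTorus_2

/-!
# Finiteness of the level quotients `U(W_j)(L₀) \ U(W_j)(𝔸) / U` of the genuine torus

A formal consequence of the compactness of `[U(W_j)] = U(1)(K) \ U(1)(𝔸_K)` (file `NormOneRelTorus`,
`compactSpace_relNormOneQuot`): for every OPEN subgroup `H ⊇ U(1)(K)` of `U(1)(𝔸_K)` the quotient `U(1)(𝔸_K) ⧸ H` is
FINITE (`NumberField.finite_relNormOneQuot_of_isOpen_of_le`); in particular for every open subgroup `U` (a level)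
the double coset space `U(1)(K) \ U(1)(𝔸_K) / U = U(1)(𝔸_K) ⧸ (U(1)(K) · U)` is finite
(`NumberField.finite_relNormOneQuot_sup_of_isOpen`) — the "class number of the torus at level `U`" is finite, so only
finitely many automorphic characters of `[U(W_j)]` have a given level (the finiteness behind PerL §4.1's decomposition of
`θ_φ(g, ·)` into finitely many `χ`-components for a `K`-finite, level-`N` Schwartz function `φ`).  Proof: the quotient is
discrete (`H` open, Mathlib `QuotientGroup.discreteTopology`) and compact (continuous image of the compact `[U(W_j)]`).
Pure proof over `NormOneRelTorus` + Mathlib; nothing cited or posited.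
-/

set_option autoImplicit false

noncomputable section

open Topology Set Function

namespace NumberField

open IsDedekindDomain

section LevelFinite

variable (K L : Type) [Field K] [Field L] [NumberField L] [Algebra K L] [FiniteDimensional K L]

/-- The change-of-level map `[U(W_j)] = U(1)(𝔸) ⧸ U(1)(K) → U(1)(𝔸) ⧸ H` for `U(1)(K) ≤ H`. -/
def relNormOneQuotMap (H : Subgroup (relNormOneIdeles K L)) (hle : relNormOneRat K L ≤ H) :
    relNormOneIdeles K L ⧸ relNormOneRat K L →* relNormOneIdeles K L ⧸ H :=
  QuotientGroup.map (relNormOneRat K L) H (MonoidHom.id _) (by simpa using hle)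

/-- (Ported verbatim from the HodgeCMPerL package; no docstring in the source.) -/
@[simp] theorem relNormOneQuotMap_mk (H : Subgroup (relNormOneIdeles K L)) (hle : relNormOneRat K L ≤ H)
    (x : relNormOneIdeles K L) :
    relNormOneQuotMap K L H hle (QuotientGroup.mk x) = QuotientGroup.mk x := rfl

/-- (Ported verbatim from the HodgeCMPerL package; no docstring in the source.) -/
theorem continuous_relNormOneQuotMap (H : Subgroup (relNormOneIdeles K L)) (hle : relNormOneRat K L ≤ H) :
    Continuous (relNormOneQuotMap K L H hle) := by
  refine (QuotientGroup.isQuotientMap_mk (relNormOneRat K L)).continuous_iff.mpr ?_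
  exact QuotientGroup.continuous_mk

/-- (Ported verbatim from the HodgeCMPerL package; no docstring in the source.) -/
theorem relNormOneQuotMap_surjective (H : Subgroup (relNormOneIdeles K L)) (hle : relNormOneRat K L ≤ H) :
    Function.Surjective (relNormOneQuotMap K L H hle) := by
  rintro ⟨x⟩
  exact ⟨QuotientGroup.mk x, rfl⟩

/-- Every quotient of `U(1)(𝔸_K)` by a subgroup containing `U(1)(K)` is compact. -/
theorem compactSpace_relNormOneQuot_of_le (H : Subgroup (relNormOneIdeles K L)) (hle : relNormOneRat K L ≤ H) :
    CompactSpace (relNormOneIdeles K L ⧸ H) := by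
  refine ⟨?_⟩
  rw [← (relNormOneQuotMap_surjective K L H hle).range_eq, ← Set.image_univ]
  exact isCompact_univ.image (continuous_relNormOneQuotMap K L H hle)

/-- **Finiteness of the level quotients of the torus.**  For every open subgroup `H ⊇ U(1)(K)` of `U(1)(𝔸_K)` the
quotient `U(1)(𝔸_K) ⧸ H` is finite. -/
theorem finite_relNormOneQuot_of_isOpen_of_le (H : Subgroup (relNormOneIdeles K L))
    (hH : IsOpen (H : Set (relNormOneIdeles K L))) (hle : relNormOneRat K L ≤ H) :
    Finite (relNormOneIdeles K L ⧸ H) := by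
  haveI : DiscreteTopology (relNormOneIdeles K L ⧸ H) := QuotientGroup.discreteTopology hH
  haveI : CompactSpace (relNormOneIdeles K L ⧸ H) := compactSpace_relNormOneQuot_of_le K L H hle
  exact finite_of_compact_of_discrete

/-- **The double coset space `U(1)(K) \ U(1)(𝔸_K) / U` is finite** for every open subgroup ("level") `U`. -/
theorem finite_relNormOneQuot_sup_of_isOpen (U : Subgroup (relNormOneIdeles K L))
    (hU : IsOpen (U : Set (relNormOneIdeles K L))) :
    Finite (relNormOneIdeles K L ⧸ (relNormOneRat K L ⊔ U)) :=
  finite_relNormOneQuot_of_isOpen_of_le K L _ (Subgroup.isOpen_mono le_sup_right hU) le_sup_left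

end LevelFinite

section CM

variable (L : Type) [Field L] [NumberField L]

/-- CM notation (`K = L⁺`; no CM hypothesis is needed for the statement): for a hermitian line over `L/L⁺`,
`U(W_j)(L₀) \ U(W_j)(𝔸) / U` is finite for every open `U ≤ U(W_j)(𝔸)`. -/
theorem finite_unitaryLineQuot_sup_of_isOpen (U : Subgroup (relNormOneIdeles (maximalRealSubfield L) L))
    (hU : IsOpen (U : Set (relNormOneIdeles (maximalRealSubfield L) L))) :
    Finite (relNormOneIdeles (maximalRealSubfield L) L ⧸ (relNormOneRat (maximalRealSubfield L) L ⊔ U)) :=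
  finite_relNormOneQuot_sup_of_isOpen (maximalRealSubfield L) L U hU

end CM

end NumberField

end
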